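/-
Copyright (c) 2026 the pub-hodgecm-mathlib formalisation cell (harness21).  Prover seat hodgecm-mathlib-LH10-p02 (g12); (G3)-EXPLICIT flag of census hand F0P3a-p06 (g25)
23:29:45Z (LEAD F0P3a-plan (g16) T15-13 «GO-LOW, your call»); G-row reader F0P3a-p09 (g14); 2026-09-03.
-/
import Summits.HodgeConjecture.HodgeConjecture.Theorems.F0P3cStCharTSEPGlueG   -- ★ (G3) p853021 (this seat): `exists_epFunction_G`, (T1) §0, `index_subgroupOf_comap_mulEquiv`; brings every input
import HarnessLib

/-!
# F0 · P3c · line LH6 «StCharTS» — CENSUS «EP-G» (G3)-EXPLICIT: KOTTWITZ'S `f_EP` ON `G_v = U(Φ₃)(L⁺_v)` WITH ITS SHAPE DISPLAYED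
# `f_G = νQv(K₀)⁻¹·𝟙_{K₀} + νQv(K₁)⁻¹·𝟙_{K₁} − νQv(I)⁻¹·𝟙_I` [Kottwitz1988 §2 Thm. 2; Rogawski1990 §12.6]

THEOREMS ONLY; lane `--kind proof --supports stmt-HodgeConjecture-24833 --as helper`; count-neutral (closes no node).  ★ (G3)
`F0P3cStCharTSEPGlueG.exists_epFunction_G` hides the function behind `∃ fG`; RIDER 2b's TRACE TABLE needs the SHAPE (`Tr σ(f_G) = dim σ^{K₀} + dim σ^{K₁} − dim σ^{I}`
through ★ `IrrClass.smoothTrace_mk_epShape`), so this file states the SAME eight clauses for the DISPLAYED function, with the one-place model `eA` (any `G_v ≃ₜ* U(σ_w, J₀)(L_w)`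
reading the matrices of ★ `localNonsplitEquiv`), the unramified datum `(ϖ, hd)`, the edge matrix `g₁ = diag(1, 1, ϖ)` and the three levels `K₀ = eA⁻¹(GL₃(𝒪_w) ∩ U)`,
`K₁ = eA⁻¹(g₁ GL₃(𝒪_w) g₁⁻¹ ∩ U)`, `I = K₀ ⊓ K₁` as BINDERS (equations `hK0 hK1 hI`, `hfG` — instantiate with `rfl`).  The proof is ★ (G3) §1's, binder for binder.

* `epFunction_G_explicit` — `IsLocSmooth fG ∧ Measurable fG ∧ Integrable fG νQv ∧ ∫ fG ∂νQv = 1 ∧ (fG 1).im = 0 ∧ (fG 1).re < 0 ∧ (Φ = 1 on elliptic regular classes) ∧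
  (Φ = 0 on non-elliptic regular classes)` for `fG = νQv(K₀)⁻¹𝟙_{K₀} + νQv(K₁)⁻¹𝟙_{K₁} − νQv(I)⁻¹𝟙_I`; inputs BY NAME as in ★ (G3): ★ (G0) p852870 (compact-open levels, indices
  `q³+1`∕`q+1`), ★ (G7) p852871 (volumes, sign), ★ EULER-G p852868 (E), ★ (G1) ASSEMBLY p853004 (N) with (T1) := ★ (G3) §0 and (T2) := ★ p852912.

HONEST LABEL: count-neutral; h413 OPEN; HC_CM is proved only modulo the 7 printed citations (2 remaining named inputs hLiu418 = `stmt-HodgeConjecture-24832`, h413 =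
`stmt-HodgeConjecture-24833`) until rung 0 closes.

## References
* [Kottwitz1988] R. E. Kottwitz, *Tamagawa numbers*, Ann. of Math. 127 (1988), §2 Theorem 2 (Euler–Poincaré functions; `Φ(γ, f_EP) = χ(𝒯^γ)`).
* [Rogawski1990] J. D. Rogawski, *Automorphic Representations of Unitary Groups in Three Variables* (1990), §12.6 p. 187, §4.9 p. 54, §3.6 pp. 28–31.
* [Tits1979] J. Tits, *Reductive groups over local fields*, PSPM 33.1 (1979), §2.4.
* [Serre1980Trees] J.-P. Serre, *Trees* (1980), II.1.1.
-/

set_option autoImplicit false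
-- the mandated namespace has the single-problem summit's repeated segment (`HodgeConjecture.HodgeConjecture`)
set_option linter.dupNamespace false

noncomputable section

open NumberField IsDedekindDomain MeasureTheory Topology
open scoped Matrix MatrixGroups Valued
open Literature.NumberTheory.Rogawski1990 Literature.NumberTheory.Automorphic Literature.NumberTheory.Automorphic.UnitaryGroup
open Literature.NumberTheory.GaloisRepresentations
open Summit.HodgeConjecture.HodgeConjecture.Cruxes.H413.F0P3cStCharTSTorusDefs
open Summit.HodgeConjecture.HodgeConjecture.Cruxes.H413.F0P3cStCharTSEPGlueG

namespace Summit.HodgeConjecture.HodgeConjecture.Cruxes.H413.F0P3cStCharTSEPGlueGExplicit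

variable (L : Type) [Field L] [NumberField L] [IsCMField L] (v : HeightOneSpectrum (𝓞 ↥(maximalRealSubfield L)))

set_option maxHeartbeats 1600000 in  -- statement-level `whnf` on the CM carriers + eight clauses, as ★ (G3) `exists_epFunction_G` and the ★ H-side twin `exists_epFunction_H`
/-- **(G3)-EXPLICIT: KOTTWITZ'S EULER–POINCARÉ FUNCTION ON `G_v = U(Φ₃)(L⁺_v)` WITH ITS SHAPE DISPLAYED** (`v` non-split, unramified datum `(ϖ, hd)` at the place `w ∣ v`;
dyadic places included).  For ANY topological one-place model `eA : G_v ≃ₜ* U(σ_w, J₀)(L_w)` reading the matrices of ★ `localNonsplitEquiv` (`heA`), the edge matrix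
`g₁ = diag(1, 1, ϖ)`, the levels `K₀ = eA⁻¹(GL₃(𝒪_w) ∩ U)`, `K₁ = eA⁻¹(g₁ GL₃(𝒪_w) g₁⁻¹ ∩ U)`, `I = K₀ ⊓ K₁` and `fG = νQv(K₀)⁻¹𝟙_{K₀} + νQv(K₁)⁻¹𝟙_{K₁} − νQv(I)⁻¹𝟙_I`
(binders `hK0 hK1 hI hfG`, all `rfl` at the consumer): `fG ∈ C_c^∞`, measurable, integrable, `∫ fG dνQv = 1`, `fG 1` real and NEGATIVE, and for every family `mQv`
canonical for (`IsRegularElt`, `νQv`) the class orbital integral of `fG` is `1` at every regular class with COMPACT centraliser and `0` at every regular class with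
NON-compact centraliser — the eight clauses of ★ `exists_epFunction_G`, token for token, for the displayed `fG`.
[cite: Kottwitz1988, §2 Theorem 2] [cite: Rogawski1990, §12.6 p. 187] [cite: Tits1979, §2.4] [cite: Serre1980Trees, II.1.1] -/
theorem epFunction_G_explicit (hns : ∀ w : PlacesOver L v, IsCMField.complexConj L • w.1 = w.1)
    (hunr : Algebra.IsUnramifiedIn (𝓞 L) v.asIdeal) (w : PlacesOver L v) (hw : IsCMField.complexConj L • w.1 = w.1)
    {ϖ : w.1.adicCompletion L} (hd : HermitianLattice.UnramifiedLocalConjDatum (galAdicCompletionMap (L := L) (IsCMField.complexConj L) hw) ϖ)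
    (g₁ : GL (Fin 3) (w.1.adicCompletion L)) (hg₁ : (g₁ : Matrix (Fin 3) (Fin 3) (w.1.adicCompletion L)) = Matrix.diagonal ![(1 : w.1.adicCompletion L), 1, ϖ])
    (eA : Gqs L v ≃ₜ* ↥(unitaryGroupOfForm (galAdicCompletionMap (L := L) (IsCMField.complexConj L) hw) ((StdForm.antidiagonal 3).over (w.1.adicCompletion L))))
    (heA : ∀ g : Gqs L v,
      ((eA g : ↥(unitaryGroupOfForm (galAdicCompletionMap (L := L) (IsCMField.complexConj L) hw) ((StdForm.antidiagonal 3).over (w.1.adicCompletion L)))) :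
          GL (Fin 3) (w.1.adicCompletion L)) =
        ((localNonsplitEquiv (IsCMField.complexConj L) (qsForm L) (IsCMField.complexConj_ne_one L) w hw g :
          ↥(unitaryGroupOfForm (galAdicCompletionMap (L := L) (IsCMField.complexConj L) hw) (placeForm (qsForm L) w.1))) : GL (Fin 3) (w.1.adicCompletion L)))
    (K0 K1 I : Subgroup (Gqs L v))
    (hK0 : K0 = ((glInt 3 (w.1.adicCompletion L)).subgroupOf
      (unitaryGroupOfForm (galAdicCompletionMap (L := L) (IsCMField.complexConj L) hw) ((StdForm.antidiagonal 3).over (w.1.adicCompletion L)))).comap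
        eA.toMulEquiv.toMonoidHom)
    (hK1 : K1 = (((glInt 3 (w.1.adicCompletion L)).map (MulAut.conj g₁).toMonoidHom).subgroupOf
      (unitaryGroupOfForm (galAdicCompletionMap (L := L) (IsCMField.complexConj L) hw) ((StdForm.antidiagonal 3).over (w.1.adicCompletion L)))).comap
        eA.toMulEquiv.toMonoidHom)
    (hI : I = K0 ⊓ K1)
    [MeasurableSpace (Gqs L v)] [BorelSpace (Gqs L v)]
    [∀ γ : Gqs L v, MeasurableSpace (Gqs L v ⧸ Subgroup.centralizer ({γ} : Set (Gqs L v)))]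
    [∀ γ : Gqs L v, BorelSpace (Gqs L v ⧸ Subgroup.centralizer ({γ} : Set (Gqs L v)))]
    (νQv : Measure (Gqs L v)) [νQv.IsHaarMeasure] [νQv.IsMulRightInvariant]
    {mQv : OrbitalMeasureFamily (Gqs L v)}
    (hcanQ : mQv.IsCanonical (fun γ => IsRegularElt (γ.val : GL (Fin 3) (UnitaryGroup.LocalRing L v))) νQv)
    (fG : Gqs L v → ℂ)
    (hfG : fG = fun g => (((νQv K0).toReal : ℂ))⁻¹ * (K0 : Set (Gqs L v)).indicator (fun _ => (1 : ℂ)) g +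
      (((νQv K1).toReal : ℂ))⁻¹ * (K1 : Set (Gqs L v)).indicator (fun _ => (1 : ℂ)) g -
      (((νQv I).toReal : ℂ))⁻¹ * (I : Set (Gqs L v)).indicator (fun _ => (1 : ℂ)) g) :
    IsLocSmooth fG ∧ Measurable fG ∧ Integrable fG νQv ∧ ∫ g, fG g ∂νQv = 1 ∧ (fG 1).im = 0 ∧ (fG 1).re < 0 ∧
      (∀ γ : Gqs L v, IsRegularElt (γ.val : GL (Fin 3) (UnitaryGroup.LocalRing L v)) →
        IsCompact ((Subgroup.centralizer ({γ} : Set (Gqs L v))) : Set (Gqs L v)) → classOrbitalIntegral mQv fG (ConjClasses.mk γ) = 1) ∧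
      (∀ γ : Gqs L v, IsRegularElt (γ.val : GL (Fin 3) (UnitaryGroup.LocalRing L v)) →
        ¬ IsCompact ((Subgroup.centralizer ({γ} : Set (Gqs L v))) : Set (Gqs L v)) → classOrbitalIntegral mQv fG (ConjClasses.mk γ) = 0) := by
  classical
  subst hfG
  subst hK0 hK1
  have hc1 : IsCMField.complexConj L ≠ 1 := IsCMField.complexConj_ne_one L
  haveI : Algebra.IsQuadraticExtension ↥(maximalRealSubfield L) L := IsCMField.isQuadraticExtension L
  have hHf : ((qsForm L).map (cmConjRingHom L))ᵀ = qsForm L := UnitaryGroup.antidiagOne_isHermitian L 3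
  have hdetf : (qsForm L).det ≠ 0 := (UnitaryGroup.isUnit_antidiagOne_det L 3).ne_zero
  set eU := localNonsplitEquiv (IsCMField.complexConj L) (qsForm L) hc1 w hw with heUdef
  haveI hTG : IsTopologicalGroup ↥(unitaryGroupOfForm (galAdicCompletionMap (L := L) (IsCMField.complexConj L) hw) ((StdForm.antidiagonal 3).over (w.1.adicCompletion L))) := inferInstance
  set K0w : Subgroup ↥(unitaryGroupOfForm (galAdicCompletionMap (L := L) (IsCMField.complexConj L) hw) ((StdForm.antidiagonal 3).over (w.1.adicCompletion L))) := (glInt 3 (w.1.adicCompletion L)).subgroupOf (unitaryGroupOfForm (galAdicCompletionMap (L := L) (IsCMField.complexConj L) hw) ((StdForm.antidiagonal 3).over (w.1.adicCompletion L))) with hK0wdef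
  set K1w : Subgroup ↥(unitaryGroupOfForm (galAdicCompletionMap (L := L) (IsCMField.complexConj L) hw) ((StdForm.antidiagonal 3).over (w.1.adicCompletion L))) := ((glInt 3 (w.1.adicCompletion L)).map (MulAut.conj g₁).toMonoidHom).subgroupOf (unitaryGroupOfForm (galAdicCompletionMap (L := L) (IsCMField.complexConj L) hw) ((StdForm.antidiagonal 3).over (w.1.adicCompletion L))) with hK1wdef
  have hI' : I = (K0w ⊓ K1w).comap eA.toMulEquiv.toMonoidHom := by rw [hI, ← Subgroup.comap_inf]
  subst hI'
  set K0 : Subgroup (Gqs L v) := K0w.comap eA.toMulEquiv.toMonoidHom with hK0def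
  set K1 : Subgroup (Gqs L v) := K1w.comap eA.toMulEquiv.toMonoidHom with hK1def
  set I : Subgroup (Gqs L v) := (K0w ⊓ K1w).comap eA.toMulEquiv.toMonoidHom with hIdef
  -- compact-open (★ (G0) §2 on `(unitaryGroupOfForm (galAdicCompletionMap (L := L) (IsCMField.complexConj L) hw) ((StdForm.antidiagonal 3).over (w.1.adicCompletion L)))`, pulled back along the homeomorphism `eA`)
  have hσc : Continuous (galAdicCompletionMap (L := L) (IsCMField.complexConj L) hw) := continuous_galAdicCompletionMap L (IsCMField.complexConj L) hw
  haveI := compactSpace_integer_adicCompletion L w.1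
  have hpre : ∀ C : Subgroup ↥(unitaryGroupOfForm (galAdicCompletionMap (L := L) (IsCMField.complexConj L) hw) ((StdForm.antidiagonal 3).over (w.1.adicCompletion L))), ((C.comap eA.toMulEquiv.toMonoidHom : Subgroup (Gqs L v)) : Set (Gqs L v)) = eA ⁻¹' (C : Set ↥(unitaryGroupOfForm (galAdicCompletionMap (L := L) (IsCMField.complexConj L) hw) ((StdForm.antidiagonal 3).over (w.1.adicCompletion L)))) := fun _ => rfl
  have hK0o : IsOpen (K0 : Set (Gqs L v)) := by
    rw [hK0def, hpre]; exact (UnitaryLatticeTree.isOpen_glInt_subgroupOf (galAdicCompletionMap (L := L) (IsCMField.complexConj L) hw) _).preimage eA.continuous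
  have hK0c : IsCompact (K0 : Set (Gqs L v)) := by
    rw [hK0def, hpre]; exact eA.toHomeomorph.isCompact_preimage.2 (UnitaryLatticeTree.isCompact_glInt_subgroupOf (galAdicCompletionMap (L := L) (IsCMField.complexConj L) hw) _ hσc)
  have hK1o : IsOpen (K1 : Set (Gqs L v)) := by
    rw [hK1def, hpre]; exact (UnitaryLatticeTree.isOpen_conj_glInt_subgroupOf (galAdicCompletionMap (L := L) (IsCMField.complexConj L) hw) _ g₁).preimage eA.continuous
  have hK1c : IsCompact (K1 : Set (Gqs L v)) := by
    rw [hK1def, hpre]; exact eA.toHomeomorph.isCompact_preimage.2 (UnitaryLatticeTree.isCompact_conj_glInt_subgroupOf (galAdicCompletionMap (L := L) (IsCMField.complexConj L) hw) _ g₁ hσc)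
  have hIo : IsOpen (I : Set (Gqs L v)) := by
    rw [hIdef, hpre]; exact (UnitaryLatticeTree.isOpen_glInt_inf_conj_glInt_subgroupOf (galAdicCompletionMap (L := L) (IsCMField.complexConj L) hw) _ g₁).preimage eA.continuous
  have hIc : IsCompact (I : Set (Gqs L v)) := by
    rw [hIdef, hpre]; exact eA.toHomeomorph.isCompact_preimage.2 (UnitaryLatticeTree.isCompact_glInt_inf_conj_glInt_subgroupOf (galAdicCompletionMap (L := L) (IsCMField.complexConj L) hw) _ g₁ hσc)
  -- volumes of compact open subgroups are finite and positive
  have hvol : ∀ S : Subgroup (Gqs L v), IsOpen (S : Set (Gqs L v)) → IsCompact (S : Set (Gqs L v)) → (((νQv S).toReal : ℂ)) ≠ 0 := by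
    intro S hSo hSc
    have hpos : 0 < νQv S := hSo.measure_pos νQv ⟨1, S.one_mem⟩
    exact_mod_cast (ENNReal.toReal_pos hpos.ne' hSc.measure_lt_top.ne).ne'
  have hint : ∀ S : Subgroup (Gqs L v), IsOpen (S : Set (Gqs L v)) → IsCompact (S : Set (Gqs L v)) → ∀ c : ℂ,
      Integrable (fun g => c * (S : Set (Gqs L v)).indicator (fun _ => (1 : ℂ)) g) νQv := fun S hSo hSc c =>
    (((isLocSmooth_indicator_subgroup S hSo hSc).continuous.integrable_of_hasCompactSupport
      (isLocSmooth_indicator_subgroup S hSo hSc).hasCompactSupport)).const_mul c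
  have hintv : ∀ S : Subgroup (Gqs L v), IsOpen (S : Set (Gqs L v)) → ∀ c : ℂ,
      ∫ g, c * (S : Set (Gqs L v)).indicator (fun _ => (1 : ℂ)) g ∂νQv = c * ((νQv S).toReal : ℂ) := by
    intro S hSo c
    rw [integral_const_mul, integral_indicator_const (1 : ℂ) hSo.measurableSet, Complex.real_smul, mul_one]
    rfl
  -- Kottwitz's function
  set fG : Gqs L v → ℂ := fun g => (((νQv K0).toReal : ℂ))⁻¹ * (K0 : Set (Gqs L v)).indicator (fun _ => (1 : ℂ)) g +
      (((νQv K1).toReal : ℂ))⁻¹ * (K1 : Set (Gqs L v)).indicator (fun _ => (1 : ℂ)) g -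
      (((νQv I).toReal : ℂ))⁻¹ * (I : Set (Gqs L v)).indicator (fun _ => (1 : ℂ)) g with hfGdef
  have hsmooth : IsLocSmooth fG := isLocSmooth_epCombination K0 K1 I hK0o hK0c hK1o hK1c hIo hIc _ _ _
  have iK0 := hint K0 hK0o hK0c ((((νQv K0).toReal : ℂ))⁻¹)
  have iK1 := hint K1 hK1o hK1c ((((νQv K1).toReal : ℂ))⁻¹)
  have iI := hint I hIo hIc ((((νQv I).toReal : ℂ))⁻¹)
  have hfG1 : fG 1 = (((νQv K0).toReal : ℂ))⁻¹ + (((νQv K1).toReal : ℂ))⁻¹ - (((νQv I).toReal : ℂ))⁻¹ := by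
    simp only [hfGdef, Set.indicator_of_mem (SetLike.mem_coe.2 K0.one_mem), Set.indicator_of_mem (SetLike.mem_coe.2 K1.one_mem),
      Set.indicator_of_mem (SetLike.mem_coe.2 I.one_mem), mul_one]
  have hfG1re : (fG 1).re = ((νQv K0).toReal)⁻¹ + ((νQv K1).toReal)⁻¹ - ((νQv I).toReal)⁻¹ := by
    rw [hfG1, ← Complex.ofReal_inv, ← Complex.ofReal_inv, ← Complex.ofReal_inv, ← Complex.ofReal_add, ← Complex.ofReal_sub, Complex.ofReal_re]
  refine ⟨hsmooth, hsmooth.continuous.measurable, (iK0.add iK1).sub iI, ?_, ?_, ?_, ?_, ?_⟩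
  · -- mass one
    have h1 : ∫ g, fG g ∂νQv = (∫ g, (((νQv K0).toReal : ℂ))⁻¹ * (K0 : Set (Gqs L v)).indicator (fun _ => (1 : ℂ)) g ∂νQv +
        ∫ g, (((νQv K1).toReal : ℂ))⁻¹ * (K1 : Set (Gqs L v)).indicator (fun _ => (1 : ℂ)) g ∂νQv) -
        ∫ g, (((νQv I).toReal : ℂ))⁻¹ * (I : Set (Gqs L v)).indicator (fun _ => (1 : ℂ)) g ∂νQv := by
      have h := integral_sub (μ := νQv)
        (f := fun g => (((νQv K0).toReal : ℂ))⁻¹ * (K0 : Set (Gqs L v)).indicator (fun _ => (1 : ℂ)) g +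
          (((νQv K1).toReal : ℂ))⁻¹ * (K1 : Set (Gqs L v)).indicator (fun _ => (1 : ℂ)) g)
        (g := fun g => (((νQv I).toReal : ℂ))⁻¹ * (I : Set (Gqs L v)).indicator (fun _ => (1 : ℂ)) g) (iK0.add iK1) iI
      rw [integral_add iK0 iK1] at h
      exact h
    rw [h1, hintv K0 hK0o, hintv K1 hK1o, hintv I hIo, inv_mul_cancel₀ (hvol K0 hK0o hK0c), inv_mul_cancel₀ (hvol K1 hK1o hK1c),
      inv_mul_cancel₀ (hvol I hIo hIc)]
    norm_num
  · -- `fG 1` is real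
    rw [hfG1, ← Complex.ofReal_inv, ← Complex.ofReal_inv, ← Complex.ofReal_inv, ← Complex.ofReal_add, ← Complex.ofReal_sub, Complex.ofReal_im]
  · -- `fG 1 < 0` (★ (G7) from the indices `q³ + 1`, `q + 1` of ★ (G0), transported along `eA`)
    letI : Fintype 𝓀[w.1.adicCompletion L] := Fintype.ofFinite _
    obtain ⟨σk, hσk⟩ := UnitaryLatticeTree.exists_residueField_ringHom_of_v_eq (K := w.1.adicCompletion L)
      (fun y => valued_galAdicCompletionMap (L := L) (IsCMField.complexConj L) hw y)
    have hidx := UnitaryLatticeTree.index_inf_subgroupOf_eq_of_unramified hd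
      (UnitaryLatticeTree.galAdicCompletionMap_mem_valuedInteger (IsCMField.complexConj L) v w hw) σk hσk
      (UnitaryLatticeTree.fintypeCard_valuedResidueField_eq_sq_of_inert (IsCMField.complexConj L) v hc1 hunr w hw)
      (UnitaryLatticeTree.residueHom_galAdicCompletionMap_eq_pow_valued (IsCMField.complexConj L) v hc1 hunr w hw σk hσk) g₁ hg₁
    have h0 : (I.subgroupOf K0).index = Nat.card (𝓞 ↥(maximalRealSubfield L) ⧸ v.asIdeal) ^ 3 + 1 := by
      rw [hIdef, hK0def, index_subgroupOf_comap_mulEquiv]; exact hidx.1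
    have h1 : (I.subgroupOf K1).index = Nat.card (𝓞 ↥(maximalRealSubfield L) ⧸ v.asIdeal) + 1 := by
      rw [hIdef, hK1def, index_subgroupOf_comap_mulEquiv]; exact hidx.2
    haveI : (I.subgroupOf K0).FiniteIndex := ⟨by rw [h0]; exact Nat.succ_ne_zero _⟩
    haveI : (I.subgroupOf K1).FiniteIndex := ⟨by rw [h1]; exact Nat.succ_ne_zero _⟩
    have hq2 : 2 ≤ Nat.card (𝓞 ↥(maximalRealSubfield L) ⧸ v.asIdeal) := by
      haveI : Finite (𝓞 ↥(maximalRealSubfield L) ⧸ v.asIdeal) := Ideal.finiteQuotientOfFreeOfNeBot v.asIdeal v.ne_bot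
      haveI : Nontrivial (𝓞 ↥(maximalRealSubfield L) ⧸ v.asIdeal) := Ideal.Quotient.nontrivial_iff.2 v.isPrime.ne_top
      exact Finite.one_lt_card
    have hmpos : 0 < (νQv I).toReal :=
      ENNReal.toReal_pos (hIo.measure_pos νQv ⟨1, I.one_mem⟩).ne' hIc.measure_lt_top.ne
    have ha : (νQv K0).toReal = ((Nat.card (𝓞 ↥(maximalRealSubfield L) ⧸ v.asIdeal) : ℝ) ^ 3 + 1) * (νQv I).toReal := by
      have h := UnitaryLatticeTree.measureReal_coe_eq_index_mul νQv (Subgroup.comap_mono inf_le_left : I ≤ K0) hIo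
      rw [h0, measureReal_def, measureReal_def] at h
      rw [h]; push_cast; ring
    have hb : (νQv K1).toReal = ((Nat.card (𝓞 ↥(maximalRealSubfield L) ⧸ v.asIdeal) : ℝ) + 1) * (νQv I).toReal := by
      have h := UnitaryLatticeTree.measureReal_coe_eq_index_mul νQv (Subgroup.comap_mono inf_le_right : I ≤ K1) hIo
      rw [h1, measureReal_def, measureReal_def] at h
      rw [h]; push_cast; ring
    rw [hfG1re]
    exact (UnitaryLatticeTree.epValueAtOne_eq_and_neg hmpos hq2 ha hb).2
  · -- elliptic regular classes: (E) = ★ EULER-G on `(unitaryGroupOfForm (galAdicCompletionMap (L := L) (IsCMField.complexConj L) hw) ((StdForm.antidiagonal 3).over (w.1.adicCompletion L)))`, finiteness from the compact centraliser and the closed regular class, counts transported along `eA`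
    intro γ hreg hZc
    haveI : CompactSpace (Subgroup.centralizer ({γ} : Set (Gqs L v))) := isCompact_iff_compactSpace.1 hZc
    have hO := UnitaryGroup.isClosed_conjClass_local_of_isRegularElt L 3 (qsForm L) v hHf hdetf γ hreg
    -- finiteness of the fixed sets, proved on `G_v` and moved to `(unitaryGroupOfForm (galAdicCompletionMap (L := L) (IsCMField.complexConj L) hw) ((StdForm.antidiagonal 3).over (w.1.adicCompletion L)))`
    have hfin : ∀ C : Subgroup ↥(unitaryGroupOfForm (galAdicCompletionMap (L := L) (IsCMField.complexConj L) hw) ((StdForm.antidiagonal 3).over (w.1.adicCompletion L))), IsOpen ((C.comap eA.toMulEquiv.toMonoidHom : Subgroup (Gqs L v)) : Set (Gqs L v)) →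
        IsCompact ((C.comap eA.toMulEquiv.toMonoidHom : Subgroup (Gqs L v)) : Set (Gqs L v)) → (MulAction.fixedBy (↥(unitaryGroupOfForm (galAdicCompletionMap (L := L) (IsCMField.complexConj L) hw) ((StdForm.antidiagonal 3).over (w.1.adicCompletion L))) ⧸ C) (eA γ)).Finite := by
      intro C hCo hCc
      haveI := (finite_fixedBy_quotient_of_isClosed γ (C.comap eA.toMulEquiv.toMonoidHom) hO hCo hCc).to_subtype
      obtain ⟨Φ, -⟩ := exists_equiv_fixedBy_quotient_congr (C.comap eA.toMulEquiv.toMonoidHom) C eA.toMulEquiv (fun g => Iff.rfl) γ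
      exact Set.finite_coe_iff.1 (Finite.of_equiv _ Φ)
    -- the centraliser of `eA γ` in `(unitaryGroupOfForm (galAdicCompletionMap (L := L) (IsCMField.complexConj L) hw) ((StdForm.antidiagonal 3).over (w.1.adicCompletion L)))` is the (compact) image of `Z(γ)`
    have hZeq : ((Subgroup.centralizer ({eA γ} : Set ↥(unitaryGroupOfForm (galAdicCompletionMap (L := L) (IsCMField.complexConj L) hw) ((StdForm.antidiagonal 3).over (w.1.adicCompletion L))))) : Set ↥(unitaryGroupOfForm (galAdicCompletionMap (L := L) (IsCMField.complexConj L) hw) ((StdForm.antidiagonal 3).over (w.1.adicCompletion L)))) = eA '' ((Subgroup.centralizer ({γ} : Set (Gqs L v))) : Set (Gqs L v)) := by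
      ext u
      simp only [SetLike.mem_coe, Subgroup.mem_centralizer_singleton_iff, Set.mem_image]
      constructor
      · intro hu
        refine ⟨eA.symm u, ?_, eA.apply_symm_apply u⟩
        apply eA.injective
        rw [map_mul, map_mul, eA.apply_symm_apply]
        exact hu
      · rintro ⟨g, hg, rfl⟩
        rw [← map_mul, ← map_mul, hg]
    have hZc' : IsCompact ((Subgroup.centralizer ({eA γ} : Set ↥(unitaryGroupOfForm (galAdicCompletionMap (L := L) (IsCMField.complexConj L) hw) ((StdForm.antidiagonal 3).over (w.1.adicCompletion L))))) : Set ↥(unitaryGroupOfForm (galAdicCompletionMap (L := L) (IsCMField.complexConj L) hw) ((StdForm.antidiagonal 3).over (w.1.adicCompletion L)))) := by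
      rw [hZeq]; exact hZc.image eA.continuous
    haveI : CompactSpace (Subgroup.centralizer ({eA γ} : Set ↥(unitaryGroupOfForm (galAdicCompletionMap (L := L) (IsCMField.complexConj L) hw) ((StdForm.antidiagonal 3).over (w.1.adicCompletion L))))) := isCompact_iff_compactSpace.1 hZc'
    have hK0wo : IsOpen (K0w : Set ↥(unitaryGroupOfForm (galAdicCompletionMap (L := L) (IsCMField.complexConj L) hw) ((StdForm.antidiagonal 3).over (w.1.adicCompletion L)))) := by
      rw [hK0wdef]; exact UnitaryLatticeTree.isOpen_glInt_subgroupOf (galAdicCompletionMap (L := L) (IsCMField.complexConj L) hw) ((StdForm.antidiagonal 3).over (w.1.adicCompletion L))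
    have horb := finite_range_pow_quotient_of_isOpen (G := ↥(unitaryGroupOfForm (galAdicCompletionMap (L := L) (IsCMField.complexConj L) hw) ((StdForm.antidiagonal 3).over (w.1.adicCompletion L)))) (eA γ) K0w hK0wo
    have hE := UnitaryLatticeTree.natCard_fixedBy_add_eq_natCard_fixedBy_inf_add_one_three hd g₁ hg₁ (eA γ) (hfin K0w hK0o hK0c) (hfin K1w hK1o hK1c) horb
    rw [hfGdef, classOrbitalIntegral_epCombination_eq_of_compactSpace L 3 (qsForm L) v νQv hHf hdetf hcanQ K0 K1 I hK0o hK0c hK1o hK1c hIo hIc γ hreg,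
      natCard_fixedBy_quotient_congr K0 K0w eA.toMulEquiv (fun g => Iff.rfl) γ, natCard_fixedBy_quotient_congr K1 K1w eA.toMulEquiv (fun g => Iff.rfl) γ,
      natCard_fixedBy_quotient_congr I (K0w ⊓ K1w) eA.toMulEquiv (fun g => Iff.rfl) γ]
    have hE' : (Nat.card (MulAction.fixedBy (↥(unitaryGroupOfForm (galAdicCompletionMap (L := L) (IsCMField.complexConj L) hw) ((StdForm.antidiagonal 3).over (w.1.adicCompletion L))) ⧸ K0w) (eA.toMulEquiv γ)) : ℂ) + (Nat.card (MulAction.fixedBy (↥(unitaryGroupOfForm (galAdicCompletionMap (L := L) (IsCMField.complexConj L) hw) ((StdForm.antidiagonal 3).over (w.1.adicCompletion L))) ⧸ K1w) (eA.toMulEquiv γ)) : ℂ) =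
        (Nat.card (MulAction.fixedBy (↥(unitaryGroupOfForm (galAdicCompletionMap (L := L) (IsCMField.complexConj L) hw) ((StdForm.antidiagonal 3).over (w.1.adicCompletion L))) ⧸ (K0w ⊓ K1w)) (eA.toMulEquiv γ)) : ℂ) + 1 := by exact_mod_cast hE
    rw [hE', add_sub_cancel_left]
  · -- non-elliptic regular classes: (N) = LH6-p03's ★ (G1) ASSEMBLY `epNonEllipticCombination_eq_zero_three`, its kit binders (T1) := §0 and (T2) := ★ p852912
    intro γ hreg hZnc
    have hnc : ¬ CompactSpace (Subgroup.centralizer ({γ} : Set (Gqs L v))) := fun h => hZnc (isCompact_iff_compactSpace.2 h)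
    -- the three levels by membership through `eU`
    have hmem : ∀ (C : Subgroup (GL (Fin 3) (w.1.adicCompletion L))) (g : Gqs L v),
        g ∈ ((C.subgroupOf (unitaryGroupOfForm (galAdicCompletionMap (L := L) (IsCMField.complexConj L) hw) ((StdForm.antidiagonal 3).over (w.1.adicCompletion L)))).comap eA.toMulEquiv.toMonoidHom : Subgroup (Gqs L v)) ↔
          ((eU g : ↥(unitaryGroupOfForm (galAdicCompletionMap (L := L) (IsCMField.complexConj L) hw) (placeForm (qsForm L) w.1))) : GL (Fin 3) (w.1.adicCompletion L)) ∈ C := by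
      intro C g
      rw [Subgroup.mem_comap, Subgroup.mem_subgroupOf, ← heA g]
      rfl
    have hImem : ∀ g : Gqs L v, g ∈ I ↔
        ((eU g : ↥(unitaryGroupOfForm (galAdicCompletionMap (L := L) (IsCMField.complexConj L) hw) (placeForm (qsForm L) w.1))) : GL (Fin 3) (w.1.adicCompletion L)) ∈ glInt 3 (w.1.adicCompletion L) ∧
          ((eU g : ↥(unitaryGroupOfForm (galAdicCompletionMap (L := L) (IsCMField.complexConj L) hw) (placeForm (qsForm L) w.1))) : GL (Fin 3) (w.1.adicCompletion L)) ∈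
            (glInt 3 (w.1.adicCompletion L)).map (MulAut.conj g₁).toMonoidHom := by
      intro g
      rw [hIdef, Subgroup.mem_comap, Subgroup.mem_inf, hK0wdef, hK1wdef, Subgroup.mem_subgroupOf, Subgroup.mem_subgroupOf, ← heA g]
      rfl
    -- the antidiagonal shape of `(Φ₃)_w`
    have hform := TypeThreeTorus.placeForm_qsForm_eq L w
    have hJ : ∀ i j : Fin 3, j ≠ Fin.rev i → placeForm (qsForm L) w.1 i j = 0 := by
      intro i j hij
      rw [hform]
      fin_cases i <;> fin_cases j <;> first | rfl | exact absurd (by decide) hij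
    have hH₀₂ : placeForm (qsForm L) w.1 0 2 ≠ 0 := by rw [hform]; exact one_ne_zero
    have hH₁₁ : placeForm (qsForm L) w.1 1 1 ≠ 0 := by rw [hform]; exact one_ne_zero
    -- (T1) := §0, valuations re-read at the datum's uniformiser `ϖ` (`|ι_w ϖ_v| = |ϖ| = exp (−1)` at the unramified `v`)
    have hvϖ' : Valued.v (toPlace v w (HeckeCharacter.uniformizer ↥(maximalRealSubfield L) v : v.adicCompletion ↥(maximalRealSubfield L))) = Valued.v ϖ := by
      rw [valued_toPlace_uniformizer L v w hunr, hd.vϖ]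
    have hT1 : ∀ γ : Gqs L v, IsRegularElt (γ.val : GL (Fin 3) (UnitaryGroup.LocalRing L v)) →
        ¬ CompactSpace (Subgroup.centralizer ({γ} : Set (Gqs L v))) →
        ∃ (g : Gqs L v) (e : Fin 3 → w.1.adicCompletion L) (c : ℤ),
          (((eU (g * γ * g⁻¹) : ↥(unitaryGroupOfForm (galAdicCompletionMap (L := L) (IsCMField.complexConj L) hw) (placeForm (qsForm L) w.1))) : GL (Fin 3) (w.1.adicCompletion L)) :
              Matrix (Fin 3) (Fin 3) (w.1.adicCompletion L)) = Matrix.diagonal e ∧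
            Valued.v (e 0) = Valued.v (ϖ ^ c) ∧ Valued.v (e 1) = 1 ∧ Valued.v (e 2) = Valued.v (ϖ ^ (-c)) := by
      intro γ hreg hncs
      have hnc' : ¬ IsCompact ((Subgroup.centralizer ({γ} : Set (Gqs L v))) : Set (Gqs L v)) := fun h => hncs (isCompact_iff_compactSpace.1 h)
      obtain ⟨γ', d, c, hconj, hm, -, hv0, hv1, hv2⟩ :=
        exists_conj_coe_localNonsplitEquiv_eq_diagonal_of_not_isCompact_centralizer L v hns hunr w hw hreg hnc'
      obtain ⟨g, hg⟩ := isConj_iff.1 hconj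
      refine ⟨g, d, c, by rw [hg]; exact hm, ?_, hv1, ?_⟩
      · rw [hv0, map_zpow₀, map_zpow₀, hvϖ']
      · rw [hv2, map_zpow₀, map_zpow₀, hvϖ']
    -- (T2) := ★ p852912 `exists_splitTorus_generator_local_of_nonsplit_three` (regularity of the diagonal from the separable characteristic polynomial)
    have hT2 : ∀ δ : Gqs L v, IsRegularElt (δ.val : GL (Fin 3) (UnitaryGroup.LocalRing L v)) →
        (∃ e : Fin 3 → w.1.adicCompletion L,
          (((eU δ : ↥(unitaryGroupOfForm (galAdicCompletionMap (L := L) (IsCMField.complexConj L) hw) (placeForm (qsForm L) w.1))) : GL (Fin 3) (w.1.adicCompletion L)) :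
              Matrix (Fin 3) (Fin 3) (w.1.adicCompletion L)) = Matrix.diagonal e) →
        ∃ τ : Subgroup.centralizer ({δ} : Set (Gqs L v)),
          (((eU (τ : Gqs L v) : ↥(unitaryGroupOfForm (galAdicCompletionMap (L := L) (IsCMField.complexConj L) hw) (placeForm (qsForm L) w.1))) : GL (Fin 3) (w.1.adicCompletion L)) :
              Matrix (Fin 3) (Fin 3) (w.1.adicCompletion L)) = Matrix.diagonal ![ϖ⁻¹, 1, ϖ] ∧
          (∀ c' : Subgroup.centralizer ({δ} : Set (Gqs L v)), ∃ n : ℤ, c' * (τ ^ n)⁻¹ ∈ compactCore (Subgroup.centralizer ({δ} : Set (Gqs L v)))) ∧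
          (∀ n : ℤ, τ ^ n ∈ compactCore (Subgroup.centralizer ({δ} : Set (Gqs L v))) → n = 0) := by
      rintro δ hregδ ⟨e, hδm⟩
      haveI := isDiscreteValuationRing_integer_of_compatible hd.vϖ
      have hsep : (Matrix.diagonal e).charpoly.Separable := by
        rw [← hδm]; exact (TypeThreeTorus.isRegularElt_iff_separable_localNonsplitEquiv L w hw _).1 hregδ
      have hinj : Function.Injective e := by
        rw [Matrix.charpoly_diagonal] at hsep; exact Polynomial.separable_prod_X_sub_C_iff.1 hsep
      exact exists_splitTorus_generator_local_of_nonsplit_three (IsCMField.complexConj L) (qsForm L) hc1 w hw hJ hH₀₂ hH₁₁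
        (isUniformizingElement_of_v_eq hd.vϖ) hd.σϖ hδm (fun i j hij => isUnit_iff_ne_zero.2 (sub_ne_zero.2 fun h => hij (hinj h)))
    -- `Φ(ν(C)⁻¹ · 𝟙_C) = ν(C)⁻¹ · Φ(𝟙_C)` ×3 (★ linearity at a regular class), then the ★ assembly
    rw [hfGdef, classOrbitalIntegral_epCombination_eq L 3 (qsForm L) v hHf hdetf hcanQ.isAdmissibleOn K0 K1 I hK0o hK0c hK1o hK1c hIo hIc _ _ _ γ hreg]
    exact epNonEllipticCombination_eq_zero_three L w hw νQv hcanQ hd g₁ hg₁ K0 K1 I (hmem _) (hmem _) hImem hK0o hK0c hK1o hK1c hIo hIc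
      hT1 hT2 γ hreg hnc

/-! ## §2 ED. 2 «LEVELS» (reader F0P3a-p09 (g14) 00:17:12Z (c1)(c2)): the three levels are compact open of non-zero volume -/

/-- **(c1) THE THREE EP LEVELS ARE COMPACT OPEN.**  For any topological one-place model `eA : G_v ≃ₜ* U(σ_w, J₀)(L_w)` and any `g₁ ∈ GL₃(L_w)`, the pull-backs
`K₀ = eA⁻¹(GL₃(𝒪_w) ∩ U)`, `K₁ = eA⁻¹(g₁ GL₃(𝒪_w) g₁⁻¹ ∩ U)`, `I = K₀ ⊓ K₁` are open and compact in `G_v` (★ (G0) `UnitaryLatticeTreeLevelIndices` §2 on `U`, pulled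
back along the homeomorphism `eA`; letters of `epFunction_G_explicit`, `rfl` ×3 at the consumer).
[cite: Tits1979, §2.4] [cite: Serre1980Trees, II.1.1] -/
theorem isOpen_isCompact_epLevels (w : PlacesOver L v) (hw : IsCMField.complexConj L • w.1 = w.1) (g₁ : GL (Fin 3) (w.1.adicCompletion L))
    (eA : Gqs L v ≃ₜ* ↥(unitaryGroupOfForm (galAdicCompletionMap (L := L) (IsCMField.complexConj L) hw) ((StdForm.antidiagonal 3).over (w.1.adicCompletion L))))
    (K0 K1 I : Subgroup (Gqs L v))
    (hK0 : K0 = ((glInt 3 (w.1.adicCompletion L)).subgroupOf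
      (unitaryGroupOfForm (galAdicCompletionMap (L := L) (IsCMField.complexConj L) hw) ((StdForm.antidiagonal 3).over (w.1.adicCompletion L)))).comap
        eA.toMulEquiv.toMonoidHom)
    (hK1 : K1 = (((glInt 3 (w.1.adicCompletion L)).map (MulAut.conj g₁).toMonoidHom).subgroupOf
      (unitaryGroupOfForm (galAdicCompletionMap (L := L) (IsCMField.complexConj L) hw) ((StdForm.antidiagonal 3).over (w.1.adicCompletion L)))).comap
        eA.toMulEquiv.toMonoidHom)
    (hI : I = K0 ⊓ K1) :
    IsOpen (K0 : Set (Gqs L v)) ∧ IsCompact (K0 : Set (Gqs L v)) ∧ IsOpen (K1 : Set (Gqs L v)) ∧ IsCompact (K1 : Set (Gqs L v)) ∧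
      IsOpen (I : Set (Gqs L v)) ∧ IsCompact (I : Set (Gqs L v)) := by
  subst hK0 hK1
  subst hI
  have hσc : Continuous (galAdicCompletionMap (L := L) (IsCMField.complexConj L) hw) := continuous_galAdicCompletionMap L (IsCMField.complexConj L) hw
  haveI := compactSpace_integer_adicCompletion L w.1
  have hpre : ∀ C : Subgroup ↥(unitaryGroupOfForm (galAdicCompletionMap (L := L) (IsCMField.complexConj L) hw) ((StdForm.antidiagonal 3).over (w.1.adicCompletion L))),
      ((C.comap eA.toMulEquiv.toMonoidHom : Subgroup (Gqs L v)) : Set (Gqs L v)) = eA ⁻¹' (C : Set _) := fun _ => rfl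
  rw [← Subgroup.comap_inf, hpre, hpre, hpre]
  exact ⟨(UnitaryLatticeTree.isOpen_glInt_subgroupOf _ _).preimage eA.continuous,
    eA.toHomeomorph.isCompact_preimage.2 (UnitaryLatticeTree.isCompact_glInt_subgroupOf _ _ hσc),
    (UnitaryLatticeTree.isOpen_conj_glInt_subgroupOf _ _ g₁).preimage eA.continuous,
    eA.toHomeomorph.isCompact_preimage.2 (UnitaryLatticeTree.isCompact_conj_glInt_subgroupOf _ _ g₁ hσc),
    (UnitaryLatticeTree.isOpen_glInt_inf_conj_glInt_subgroupOf _ _ g₁).preimage eA.continuous,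
    eA.toHomeomorph.isCompact_preimage.2 (UnitaryLatticeTree.isCompact_glInt_inf_conj_glInt_subgroupOf _ _ g₁ hσc)⟩

/-- **(c2) THE THREE EP LEVELS HAVE NON-ZERO (REAL) HAAR VOLUME** (compact open subgroups contain `1`; ★ `IsOpen.measure_pos`, `IsCompact.measure_lt_top`) — the
`hμ₀ hμ₁ hμI` binders of ★ INDIC-COMB `IrrClass.smoothTrace_mk_epShape` in the letters of `epFunction_G_explicit`. [cite: Kottwitz1988, §2 Theorem 2] -/
theorem measureReal_epLevels_ne_zero (w : PlacesOver L v) (hw : IsCMField.complexConj L • w.1 = w.1) (g₁ : GL (Fin 3) (w.1.adicCompletion L))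
    (eA : Gqs L v ≃ₜ* ↥(unitaryGroupOfForm (galAdicCompletionMap (L := L) (IsCMField.complexConj L) hw) ((StdForm.antidiagonal 3).over (w.1.adicCompletion L))))
    (K0 K1 I : Subgroup (Gqs L v))
    (hK0 : K0 = ((glInt 3 (w.1.adicCompletion L)).subgroupOf
      (unitaryGroupOfForm (galAdicCompletionMap (L := L) (IsCMField.complexConj L) hw) ((StdForm.antidiagonal 3).over (w.1.adicCompletion L)))).comap
        eA.toMulEquiv.toMonoidHom)
    (hK1 : K1 = (((glInt 3 (w.1.adicCompletion L)).map (MulAut.conj g₁).toMonoidHom).subgroupOf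
      (unitaryGroupOfForm (galAdicCompletionMap (L := L) (IsCMField.complexConj L) hw) ((StdForm.antidiagonal 3).over (w.1.adicCompletion L)))).comap
        eA.toMulEquiv.toMonoidHom)
    (hI : I = K0 ⊓ K1) [MeasurableSpace (Gqs L v)] [BorelSpace (Gqs L v)] (νQv : Measure (Gqs L v)) [νQv.IsHaarMeasure] :
    νQv.real (K0 : Set (Gqs L v)) ≠ 0 ∧ νQv.real (K1 : Set (Gqs L v)) ≠ 0 ∧ νQv.real (I : Set (Gqs L v)) ≠ 0 := by
  obtain ⟨hK0o, hK0c, hK1o, hK1c, hIo, hIc⟩ := isOpen_isCompact_epLevels L v w hw g₁ eA K0 K1 I hK0 hK1 hI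
  have hvol : ∀ S : Subgroup (Gqs L v), IsOpen (S : Set (Gqs L v)) → IsCompact (S : Set (Gqs L v)) → νQv.real (S : Set (Gqs L v)) ≠ 0 := fun S hSo hSc =>
    (ENNReal.toReal_pos (hSo.measure_pos νQv ⟨1, S.one_mem⟩).ne' hSc.measure_lt_top.ne).ne'
  exact ⟨hvol K0 hK0o hK0c, hvol K1 hK1o hK1c, hvol I hIo hIc⟩

end Summit.HodgeConjecture.HodgeConjecture.Cruxes.H413.F0P3cStCharTSEPGlueGExplicit

end
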